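import Summits.Ventures.PercRepro.C041TriDomExcessWeighted

/-!
# ROW C-041 — THE SYMMETRIC EXCESS AT EVERY EDGE PROBABILITY, III: a quantitative lower bound
(p6, gen 42; P6-TWOEXIT-LEAN.md §53 ADDENDUM 8)

Iterating THE WEIGHTED RECURSION (`esymW_rec_ge`) and dropping its deletion / contraction term (non-negative by
`esymW_nonneg`): the weighted symmetric excess of any status is at least `∏_{f free} (2 w f − 1)` times the weighted
excess of the status in which every free edge is FORCED RED (`forceAll`, `absentAll`; `esymW_ge_forceAll`).  Without
free edges the patterns do not depend on the colouring and the weights sum to one (`sum_cwt_eq_one`, by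
`Fintype.prod_sum`), so the latter is `Fsym (red pattern) (blue pattern)` of that status (`esymW_of_nofree_eq`).  For
the host with every edge free this is **THEOREM (LOWER BOUND)** `esymP_ge_prod`: the expectation of `Fsym (π_R) (π_B)`
is at least `∏_e (2 w e − 1)` times `Fsym` at the host's own connectivity pattern of the three marks and the pattern
of their coincidences — for three DISTINCT marks CONNECTED in the host (`hostConnected`), at least `∏_e (2 w e − 1)`
(`esymP_ge_prod_of_connected`): the symmetric excess is STRICTLY positive at every edge probability `> ½` as soon as
the marks are connected (and, by complementation, at every edge probability `< ½`).
-/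

namespace PercRepro

namespace ZoneZ

namespace MultiExit

open ZoneData Finset

variable {V₁ E₁ U₁ U₂ : Type} (Z₁ : ZoneData V₁ E₁ U₁ U₂) (u u' a₁ : V₁)

/-! ## Forcing every free edge red -/

/-- The forced set after forcing every free edge of `st` red. -/
def forceAll (R : E₁ → Prop) (st : E₁ → EStat) : E₁ → Prop := fun e => R e ∨ st e = .free

/-- The status after forcing every free edge red (the free edges become absent, the others are unchanged). -/
def absentAll (st : E₁ → EStat) : E₁ → EStat := fun e => if st e = .free then .absent else st e

variable [DecidableEq E₁]

/-- Forcing one free edge first does not change the final forced set. -/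
theorem forceAll_update (R : E₁ → Prop) (st : E₁ → EStat) (f : E₁) (hf : st f = .free) :
    forceAll (fun e => R e ∨ e = f) (Function.update st f .absent) = forceAll R st := by
  funext e
  unfold forceAll
  by_cases he : e = f
  · subst he; simp [hf]
  · simp [he]

/-- Forcing one free edge first does not change the final status. -/
theorem absentAll_update (st : E₁ → EStat) (f : E₁) (hf : st f = .free) :
    absentAll (Function.update st f .absent) = absentAll st := by
  funext e
  unfold absentAll
  by_cases he : e = f
  · subst he; simp [hf]
  · simp [Function.update_of_ne he]

omit [DecidableEq E₁] in
/-- Without free edges `forceAll` is the forced set itself. -/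
theorem forceAll_of_nofree (R : E₁ → Prop) (st : E₁ → EStat) (hst : ∀ e, st e ≠ .free) : forceAll R st = R := by
  funext e
  simp [forceAll, hst e]

omit [DecidableEq E₁] in
/-- Without free edges `absentAll` is the status itself. -/
theorem absentAll_of_nofree (st : E₁ → EStat) (hst : ∀ e, st e ≠ .free) : absentAll st = st := by
  funext e
  simp [absentAll, hst e]

omit [DecidableEq E₁] in
/-- `absentAll` has no free edge. -/
theorem absentAll_nofree (st : E₁ → EStat) (e : E₁) : absentAll st e ≠ .free := by
  unfold absentAll
  by_cases h : st e = .free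
  · simp [h]
  · simp [h]

variable [Fintype E₁]

/-- **THE ITERATED RECURSION**: the weighted excess of a status is at least the product of `2 w f − 1` over its free
edges times the weighted excess of the status with every free edge forced red. -/
theorem esymW_ge_forceAll (R : E₁ → Prop) (st : E₁ → EStat) (w : E₁ → ℚ) (hw : ∀ e, 1 / 2 ≤ w e ∧ w e ≤ 1) :
    (∏ e ∈ univ.filter (fun e => st e = .free), (2 * w e - 1))
        * esymW Z₁ u u' a₁ (forceAll R st) (absentAll st) w ≤ esymW Z₁ u u' a₁ R st w := by
  have hw01 : ∀ e, 0 ≤ w e ∧ w e ≤ 1 := fun e => ⟨by linarith [(hw e).1], (hw e).2⟩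
  suffices h : ∀ n : ℕ, ∀ (R : E₁ → Prop) (st : E₁ → EStat), nfree st = n →
      (∏ e ∈ univ.filter (fun e => st e = .free), (2 * w e - 1))
        * esymW Z₁ u u' a₁ (forceAll R st) (absentAll st) w ≤ esymW Z₁ u u' a₁ R st w from h _ R st rfl
  intro n
  induction n with
  | zero =>
    intro R st hst
    have hno : ∀ e, st e ≠ .free := by
      intro e he
      have : e ∈ (univ.filter fun e => st e = .free) := by simp [he]
      rw [Finset.card_eq_zero.mp hst] at this
      simp at this
    have hempty : (univ.filter fun e => st e = .free) = ∅ := Finset.card_eq_zero.mp hst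
    rw [hempty, Finset.prod_empty, one_mul, forceAll_of_nofree R st hno, absentAll_of_nofree st hno]
  | succ n ih =>
    intro R st hst
    have hne : (univ.filter fun e => st e = .free).Nonempty := by
      rw [← Finset.card_pos]; unfold nfree at hst; omega
    obtain ⟨f, hf⟩ := hne
    have hf' : st f = .free := (Finset.mem_filter.mp hf).2
    have hfilt : (univ.filter fun e => Function.update st f EStat.absent e = .free) =
        (univ.filter fun e => st e = .free).erase f := by
      ext e
      by_cases he : e = f
      · subst he; simp
      · simp [he]
    have hih := ih (fun e => R e ∨ e = f) (Function.update st f .absent) (by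
      have := nfree_update hf' (s := .absent) (by decide); omega)
    rw [hfilt, forceAll_update R st f hf', absentAll_update st f hf'] at hih
    have hrec := esymW_rec_ge Z₁ u u' a₁ R st w hw01 f hf'
    have hc1 : 0 ≤ 2 * w f - 1 := by linarith [(hw f).1]
    have hc2 : 0 ≤ 1 - w f := by linarith [(hw f).2]
    have h2 := esymW_nonneg Z₁ u u' a₁ R (Function.update st f .absent) w hw
    have h3 := esymW_nonneg Z₁ u u' a₁ R (Function.update st f .double) w hw
    have hprod : ∏ e ∈ univ.filter (fun e => st e = .free), (2 * w e - 1) =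
        (2 * w f - 1) * ∏ e ∈ (univ.filter fun e => st e = .free).erase f, (2 * w e - 1) :=
      (Finset.mul_prod_erase _ (fun e => 2 * w e - 1) hf).symm
    rw [hprod, mul_assoc]
    have := mul_le_mul_of_nonneg_left hih hc1
    nlinarith [mul_nonneg hc2 (add_nonneg h2 h3)]

/-! ## Statuses without free edges -/

/-- The weights of the colourings sum to one. -/
theorem sum_cwt_eq_one (w : E₁ → ℚ) : ∑ ω : E₁ → Bool, cwt w ω = 1 := by
  unfold cwt
  rw [← Fintype.prod_sum]
  simp [wt]

omit [DecidableEq E₁] [Fintype E₁] in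
/-- Without free edges the forced red pattern does not depend on the colouring. -/
theorem rsigF_of_nofree_eq (R : E₁ → Prop) (st : E₁ → EStat) (hst : ∀ e, st e ≠ .free) (ω ω' : E₁ → Bool) :
    rsigF Z₁ u u' a₁ R st ω = rsigF Z₁ u u' a₁ R st ω' := by
  refine rsigF_congr Z₁ u u' a₁ R (RAdjF_congr Z₁ R fun e => ?_)
  simp [redE, hst e]

omit [DecidableEq E₁] [Fintype E₁] in
/-- Without free edges the blue pattern does not depend on the colouring. -/
theorem bsig_of_nofree_eq (st : E₁ → EStat) (hst : ∀ e, st e ≠ .free) (ω ω' : E₁ → Bool) :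
    bsig Z₁ u u' a₁ st ω = bsig Z₁ u u' a₁ st ω' := by
  refine bsig_congr Z₁ u u' a₁ (BAdjS_congr Z₁ fun e => ?_)
  simp [blueE, hst e]

/-- Without free edges the weighted excess is the value of `Fsym` at the (colouring-independent) patterns. -/
theorem esymW_of_nofree_eq (R : E₁ → Prop) (st : E₁ → EStat) (hst : ∀ e, st e ≠ .free) (w : E₁ → ℚ) :
    esymW Z₁ u u' a₁ R st w =
      (Fsym (rsigF Z₁ u u' a₁ R st (fun _ => false)) (bsig Z₁ u u' a₁ st (fun _ => false)) : ℚ) := by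
  unfold esymW
  have h : ∀ ω : E₁ → Bool, cwt w ω * (Fsym (rsigF Z₁ u u' a₁ R st ω) (bsig Z₁ u u' a₁ st ω) : ℚ) =
      cwt w ω * (Fsym (rsigF Z₁ u u' a₁ R st (fun _ => false)) (bsig Z₁ u u' a₁ st (fun _ => false)) : ℚ) := by
    intro ω
    rw [rsigF_of_nofree_eq Z₁ u u' a₁ R st hst ω (fun _ => false), bsig_of_nofree_eq Z₁ u u' a₁ st hst ω (fun _ => false)]
  simp only [h, ← Finset.sum_mul, sum_cwt_eq_one, one_mul]

/-! ## The host with every edge free -/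

/-- **THEOREM (LOWER BOUND)**: for the host with every edge free and all edge probabilities in `[½, 1]`, the weighted
symmetric excess is at least `∏_e (2 w e − 1)` times `Fsym` at the host's own connectivity pattern of the marks (every
edge forced red) and the pattern of their coincidences (no edge). -/
theorem esymP_ge_prod (w : E₁ → ℚ) (hw : ∀ e, 1 / 2 ≤ w e ∧ w e ≤ 1) :
    (∏ e, (2 * w e - 1)) * (Fsym (rsigF Z₁ u u' a₁ (fun _ => True) (fun _ => EStat.absent) (fun _ => false))
        (bsig Z₁ u u' a₁ (fun _ => EStat.absent) (fun _ => false)) : ℚ) ≤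
      ∑ ω : E₁ → Bool, cwt w ω *
        (Fsym (rsig Z₁ u u' a₁ (fun _ => EStat.free) ω) (bsig Z₁ u u' a₁ (fun _ => EStat.free) ω) : ℚ) := by
  have h := esymW_ge_forceAll Z₁ u u' a₁ (fun _ => False) (fun _ => EStat.free) w hw
  have hR : forceAll (fun _ => False) (fun _ => EStat.free) = (fun _ : E₁ => True) := by
    funext e; simp [forceAll]
  have hst : absentAll (fun _ => EStat.free) = (fun _ : E₁ => EStat.absent) := by
    funext e; simp [absentAll]
  have hfilt : (univ.filter fun e : E₁ => (fun _ => EStat.free) e = EStat.free) = univ := by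
    ext e; simp
  rw [hR, hst, hfilt, esymW_of_nofree_eq Z₁ u u' a₁ _ _ (fun _ => by simp) w] at h
  unfold esymW at h
  simpa only [rsigF_false] using h

/-- The three marks are connected in the host: the pattern with every edge forced red is `⊤`. -/
def hostConnected : Prop :=
  rsigF Z₁ u u' a₁ (fun _ => True) (fun _ => EStat.absent) (fun _ => false) = (true, true, true)

omit [DecidableEq E₁] [Fintype E₁] in
open Classical in
/-- With every edge absent the blue pattern is the pattern of the coincidences of the marks. -/
theorem bsig_absent_eq (ω : E₁ → Bool) :
    bsig Z₁ u u' a₁ (fun _ => EStat.absent) ω = (decide (a₁ = u), decide (a₁ = u'), decide (u = u')) := by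
  have hB : BAdjS Z₁ (fun _ => EStat.absent) ω = fun _ _ => False := by
    funext x y
    simp [BAdjS, blueE]
  have hreach : ∀ k v : V₁, v ∈ ZoneData.reach (fun _ _ : V₁ => False) {k} ↔ k = v := by
    intro k v
    rw [mem_reach_singleton]
    constructor
    · intro h
      induction h with
      | refl => rfl
      | tail _ hb _ => exact hb.elim
    · rintro rfl; exact Relation.ReflTransGen.refl
  simp only [bsig, MgS, hB, hreach]

open Classical in
/-- **THEOREM (LOWER BOUND, CONNECTED MARKS)**: for three distinct marks connected in the host and all edge
probabilities in `[½, 1]`, the weighted symmetric excess is at least `∏_e (2 w e − 1)` — strictly positive as soon as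
every `w e > ½`. -/
theorem esymP_ge_prod_of_connected (hc : hostConnected Z₁ u u' a₁) (h1 : a₁ ≠ u) (h2 : a₁ ≠ u') (h3 : u ≠ u')
    (w : E₁ → ℚ) (hw : ∀ e, 1 / 2 ≤ w e ∧ w e ≤ 1) :
    ∏ e, (2 * w e - 1) ≤ ∑ ω : E₁ → Bool, cwt w ω *
      (Fsym (rsig Z₁ u u' a₁ (fun _ => EStat.free) ω) (bsig Z₁ u u' a₁ (fun _ => EStat.free) ω) : ℚ) := by
  have h := esymP_ge_prod Z₁ u u' a₁ w hw
  unfold hostConnected at hc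
  rw [hc, bsig_absent_eq, decide_eq_false h1, decide_eq_false h2, decide_eq_false h3] at h
  have hF : Fsym (true, true, true) (false, false, false) = 1 := by decide
  rw [hF] at h
  push_cast at h
  simpa using h

end MultiExit

end ZoneZ

end PercRepro
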